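import Summits.CriticalPhenomena.PercolationContinuityZ3.Theorems.SahiBoxTP2Positivity
import Mathlib.Analysis.SpecialFunctions.Sigmoid

/-!
# Box-TP₂ laws on `ℝ^d`: Sahi positivity given the continuous case; MTP₂ densities for product reference measures

Support file of the Sahi cell (`prim-sahi`, typer seat, generation 11; `--supports stmt-CriticalPhenomena-4575`).

The coordinatewise sigmoid `ℝ^d → (0,1)^d ⊂ Q_d` is a measurable order embedding mapping closed boxes into closed
boxes, so it transports `SahiBoxTP2Split.IsBoxTP2` (`IsBoxTP2.map_sigmoidPi`; the boxes of `Q_d` touching the faces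
are increasing unions of images of boxes of `ℝ^d`, `measure_mul_le_of_monotone_iUnion`), and its inverse (the
coordinatewise logit) is monotone on the open cube, which carries the image law; with the a.e.-monotone coupling of
`SahiBoxTP2Coupling.lean` this gives

* **`msahiE_nonneg_of_isBoxTP2_real`** / `…_antitone` — `LiebSahiContinuum d n` ⟹ every box-TP₂ probability
  measure on `ℝ^d` is Sahi-positive of order `n` for all BOUNDED measurable nonnegative monotone (antitone) families
  (boundedness is needed on `ℝ^d`: the coupling is only a.e. monotone and the envelope needs a bound);
* `IsBoxTP2.withDensity_pi` — a measurable MTP₂ density (`ρ(x)ρ(y) ≤ ρ(x ∨ y)ρ(x ∧ y)`) with respect to ANY product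
  of σ-finite measures on `ℝ^d` gives a box-TP₂ law (Karlin–Rinott's four functions theorem, tree
  `Literature.Probability.LatticeModels.lintegral_four_functions`); e.g. Gaussian vectors whose precision matrix has
  nonpositive off-diagonal entries, or discrete MTP₂ laws on `ℤ^d ⊂ ℝ^d` (counting reference measure);
* unconditional layers `msahiE_nonneg_of_isBoxTP2_real_of_le_two` (`d ≤ 2`, all `n`) and
  `…_of_order_le_two` (`n ≤ 2`, all `d`: the FKG inequality for box-TP₂ laws on `ℝ^d`); the cell `(3,3)` is in
  `SahiBoxTP2GridThree.lean`.

No sorries, no new axioms.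
-/

noncomputable section

namespace Summit.CriticalPhenomena.PercolationContinuityZ3.Theorems.SahiBoxTP2

open MeasureTheory ProbabilityTheory Set Filter Topology Function Literature.Combinatorics.Sahi2008
open scoped ENNReal unitInterval

/-! ### Monotone limits of the four-term inequality -/

/-- **Passing to increasing unions in `μ(A)μ(B) ≤ μ(C)μ(D)`.** [folklore] -/
theorem measure_mul_le_of_monotone_iUnion {Ω : Type*} [MeasurableSpace Ω] (μ : Measure Ω) {A B C D : ℕ → Set Ω}
    (hA : Monotone A) (hB : Monotone B) (hC : Monotone C) (hD : Monotone D)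
    (h : ∀ k, μ (A k) * μ (B k) ≤ μ (C k) * μ (D k)) :
    μ (⋃ k, A k) * μ (⋃ k, B k) ≤ μ (⋃ k, C k) * μ (⋃ k, D k) := by
  rw [hA.measure_iUnion, hB.measure_iUnion, hC.measure_iUnion, hD.measure_iUnion, ENNReal.iSup_mul]
  refine iSup_le fun k => ?_
  rw [ENNReal.mul_iSup]
  refine iSup_le fun l => ?_
  calc μ (A k) * μ (B l) ≤ μ (A (max k l)) * μ (B (max k l)) :=
        mul_le_mul' (measure_mono (hA (le_max_left k l))) (measure_mono (hB (le_max_right k l)))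
    _ ≤ μ (C (max k l)) * μ (D (max k l)) := h _
    _ ≤ (⨆ i, μ (C i)) * ⨆ i, μ (D i) := mul_le_mul' (le_iSup (fun i => μ (C i)) _) (le_iSup (fun i => μ (D i)) _)

/-! ### The coordinatewise sigmoid and logit -/

/-- The logit `v ↦ log(v/(1−v))`, inverse of the sigmoid on `(0,1)` (value irrelevant at the endpoints). [folklore] -/
def logit (v : I) : ℝ := Real.log ((v : ℝ) / (1 - v))

/-- `sigmoid (logit v) = v` on `(0,1)`. [folklore] -/
theorem sigmoid_logit {v : I} (hv : (v : ℝ) ∈ Ioo 0 1) : unitInterval.sigmoid (logit v) = v := by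
  apply Subtype.ext
  change Real.sigmoid (logit v) = v
  have hv0 : (0 : ℝ) < v := hv.1
  have hv1 : (0 : ℝ) < 1 - v := sub_pos.2 hv.2
  rw [Real.sigmoid_def, logit, ← Real.log_inv, Real.exp_log (inv_pos.2 (div_pos hv0 hv1)), inv_div]
  field_simp
  ring

/-- `logit (sigmoid x) = x`. [folklore] -/
theorem logit_sigmoid (x : ℝ) : logit (unitInterval.sigmoid x) = x :=
  unitInterval.sigmoid_injective
    (sigmoid_logit ⟨unitInterval.sigmoid_pos x, unitInterval.sigmoid_lt_one x⟩)

/-- The logit is measurable. [folklore] -/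
theorem measurable_logit : Measurable logit :=
  Real.measurable_log.comp ((measurable_subtype_coe).div (measurable_const.sub measurable_subtype_coe))

/-- The logit is monotone on `(0,1)`. [folklore] -/
theorem logit_le_logit {u v : I} (hu : (u : ℝ) ∈ Ioo 0 1) (hv : (v : ℝ) ∈ Ioo 0 1) (huv : u ≤ v) :
    logit u ≤ logit v := by
  rw [← unitInterval.sigmoid_le_iff, sigmoid_logit hu, sigmoid_logit hv]
  exact huv

/-- `sigmoid x ≤ v ⟺ x ≤ logit v` for `v ∈ (0,1)`. [folklore] -/
theorem sigmoid_le_iff_le_logit (x : ℝ) {v : I} (hv : (v : ℝ) ∈ Ioo 0 1) :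
    unitInterval.sigmoid x ≤ v ↔ x ≤ logit v := by
  rw [← unitInterval.sigmoid_le_iff, sigmoid_logit hv]

/-- `v ≤ sigmoid x ⟺ logit v ≤ x` for `v ∈ (0,1)`. [folklore] -/
theorem le_sigmoid_iff_logit_le (x : ℝ) {v : I} (hv : (v : ℝ) ∈ Ioo 0 1) :
    v ≤ unitInterval.sigmoid x ↔ logit v ≤ x := by
  rw [← unitInterval.sigmoid_le_iff, sigmoid_logit hv]

variable {d n : ℕ}

/-- The coordinatewise sigmoid `ℝ^d → Q_d`. [folklore] -/
def sigmoidPi (x : Fin d → ℝ) : Fin d → I := fun j => unitInterval.sigmoid (x j)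

/-- The coordinatewise logit `Q_d → ℝ^d`. [folklore] -/
def logitPi (u : Fin d → I) : Fin d → ℝ := fun j => logit (u j)

/-- The coordinatewise sigmoid is measurable. [folklore] -/
theorem measurable_sigmoidPi : Measurable (sigmoidPi (d := d)) :=
  measurable_pi_iff.2 fun j => unitInterval.continuous_sigmoid.measurable.comp (measurable_pi_apply j)

/-- The coordinatewise logit is measurable. [folklore] -/
theorem measurable_logitPi : Measurable (logitPi (d := d)) :=
  measurable_pi_iff.2 fun j => measurable_logit.comp (measurable_pi_apply j)

/-- `logitPi ∘ sigmoidPi = id`. [folklore] -/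
theorem logitPi_sigmoidPi (x : Fin d → ℝ) : logitPi (sigmoidPi x) = x :=
  funext fun j => logit_sigmoid (x j)

/-- The open cube `(0,1)^d ⊂ Q_d`. [folklore] -/
def openCube (d : ℕ) : Set (Fin d → I) := {u | ∀ j, ((u j : I) : ℝ) ∈ Ioo 0 1}

/-- The open cube is measurable. [folklore] -/
theorem measurableSet_openCube : MeasurableSet (openCube d) := by
  have h : openCube d = ⋂ j, (fun u : Fin d → I => ((u j : I) : ℝ)) ⁻¹' Ioo 0 1 := by
    ext u; simp [openCube]
  rw [h]
  exact MeasurableSet.iInter fun j => (measurable_subtype_coe.comp (measurable_pi_apply j)) measurableSet_Ioo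

/-- The coordinatewise sigmoid lands in the open cube. [folklore] -/
theorem sigmoidPi_mem_openCube (x : Fin d → ℝ) : sigmoidPi x ∈ openCube d :=
  fun j => ⟨unitInterval.sigmoid_pos (x j), unitInterval.sigmoid_lt_one (x j)⟩

/-- The coordinatewise logit is monotone on the open cube. [folklore] -/
theorem logitPi_monotoneOn : MonotoneOn (logitPi (d := d)) (openCube d) :=
  fun _ hu _ hv huv j => logit_le_logit (hu j) (hv j) (huv j)

/-- Preimage of a closed box of the open cube under the coordinatewise sigmoid is the closed box of the logits.
[folklore] -/
theorem sigmoidPi_preimage_Icc {a b : Fin d → I} (ha : a ∈ openCube d) (hb : b ∈ openCube d) :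
    sigmoidPi ⁻¹' Icc a b = Icc (logitPi a) (logitPi b) := by
  ext x
  simp only [mem_preimage, mem_Icc, Pi.le_def, sigmoidPi, logitPi]
  exact and_congr (forall_congr' fun j => le_sigmoid_iff_logit_le (x j) (ha j))
    (forall_congr' fun j => sigmoid_le_iff_le_logit (x j) (hb j))

/-- The logit of a pointwise meet in the open cube. [folklore] -/
theorem logitPi_inf {a a' : Fin d → I} (ha : a ∈ openCube d) (ha' : a' ∈ openCube d) :
    logitPi (a ⊓ a') = logitPi a ⊓ logitPi a' := by
  funext j
  simp only [logitPi, Pi.inf_apply]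
  rcases le_total (a j) (a' j) with h | h
  · rw [inf_eq_left.2 h, inf_eq_left.2 (logit_le_logit (ha j) (ha' j) h)]
  · rw [inf_eq_right.2 h, inf_eq_right.2 (logit_le_logit (ha' j) (ha j) h)]

/-- The logit of a pointwise join in the open cube. [folklore] -/
theorem logitPi_sup {a a' : Fin d → I} (ha : a ∈ openCube d) (ha' : a' ∈ openCube d) :
    logitPi (a ⊔ a') = logitPi a ⊔ logitPi a' := by
  funext j
  simp only [logitPi, Pi.sup_apply]
  rcases le_total (a j) (a' j) with h | h
  · rw [sup_eq_right.2 h, sup_eq_right.2 (logit_le_logit (ha j) (ha' j) h)]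
  · rw [sup_eq_left.2 h, sup_eq_left.2 (logit_le_logit (ha' j) (ha j) h)]

/-! ### Box-TP₂ passes from `ℝ^d` to the image law on `Q_d` -/

/-- Inner truncation level below: `σ(−k) ↓ 0`. [folklore] -/
def loLevel (d k : ℕ) : Fin d → I := fun _ => unitInterval.sigmoid (-(k : ℝ))

/-- Inner truncation level above: `σ(k) ↑ 1`. [folklore] -/
def hiLevel (d k : ℕ) : Fin d → I := fun _ => unitInterval.sigmoid (k : ℝ)

/-- A lower corner with no coordinate equal to `1`, raised to level `σ(−k)`, lies in the open cube. [folklore] -/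
theorem sup_loLevel_mem_openCube {a : Fin d → I} (ha : ∀ j, ((a j : I) : ℝ) < 1) (k : ℕ) :
    a ⊔ loLevel d k ∈ openCube d := fun j => by
  change ((a j ⊔ unitInterval.sigmoid (-(k : ℝ)) : I) : ℝ) ∈ Ioo 0 1
  rcases le_total (a j) (unitInterval.sigmoid (-(k : ℝ))) with h | h
  · rw [sup_eq_right.2 h]; exact ⟨unitInterval.sigmoid_pos _, unitInterval.sigmoid_lt_one _⟩
  · rw [sup_eq_left.2 h]
    exact ⟨lt_of_lt_of_le (unitInterval.sigmoid_pos (-(k : ℝ))) (Subtype.coe_le_coe.2 h), ha j⟩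

/-- An upper corner with no coordinate equal to `0`, lowered to level `σ(k)`, lies in the open cube. [folklore] -/
theorem inf_hiLevel_mem_openCube {b : Fin d → I} (hb : ∀ j, (0 : ℝ) < ((b j : I) : ℝ)) (k : ℕ) :
    b ⊓ hiLevel d k ∈ openCube d := fun j => by
  change ((b j ⊓ unitInterval.sigmoid (k : ℝ) : I) : ℝ) ∈ Ioo 0 1
  rcases le_total (b j) (unitInterval.sigmoid (k : ℝ)) with h | h
  · rw [inf_eq_left.2 h]
    exact ⟨hb j, lt_of_le_of_lt (Subtype.coe_le_coe.2 h) (unitInterval.sigmoid_lt_one _)⟩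
  · rw [inf_eq_right.2 h]; exact ⟨unitInterval.sigmoid_pos _, unitInterval.sigmoid_lt_one _⟩

/-- The truncated boxes increase with `k`. [folklore] -/
theorem monotone_truncBox (a b : Fin d → I) :
    Monotone fun k : ℕ => sigmoidPi ⁻¹' Icc (a ⊔ loLevel d k) (b ⊓ hiLevel d k) := by
  intro k l hkl
  refine preimage_mono (Icc_subset_Icc (sup_le_sup_left (fun j => ?_) a) (inf_le_inf_left b fun j => ?_))
  · exact unitInterval.sigmoid_monotone (neg_le_neg (by exact_mod_cast hkl))
  · exact unitInterval.sigmoid_monotone (by exact_mod_cast hkl)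

/-- The preimage of a closed box of `Q_d` under the coordinatewise sigmoid is the increasing union of the preimages
of its truncations. [folklore] -/
theorem sigmoidPi_preimage_Icc_eq_iUnion (a b : Fin d → I) :
    sigmoidPi ⁻¹' Icc a b = ⋃ k : ℕ, sigmoidPi ⁻¹' Icc (a ⊔ loLevel d k) (b ⊓ hiLevel d k) := by
  ext x
  simp only [mem_preimage, mem_iUnion, mem_Icc]
  constructor
  · rintro ⟨hax, hxb⟩
    obtain ⟨k, hk⟩ := exists_nat_ge (⨆ j, |x j|)
    have hkj : ∀ j, |x j| ≤ k := fun j => (le_ciSup (Finite.bddAbove_range fun j => |x j|) j).trans hk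
    refine ⟨k, sup_le hax fun j => ?_, le_inf hxb fun j => ?_⟩
    · exact unitInterval.sigmoid_monotone (neg_le.1 ((neg_le_abs (x j)).trans (hkj j)))
    · exact unitInterval.sigmoid_monotone ((le_abs_self (x j)).trans (hkj j))
  · rintro ⟨k, hax, hxb⟩
    exact ⟨le_sup_left.trans hax, hxb.trans inf_le_left⟩

/-- A box with a lower corner coordinate `1` or an upper corner coordinate `0` has empty preimage (the sigmoid
misses `0` and `1`). [folklore] -/
theorem sigmoidPi_preimage_Icc_eq_empty {a b : Fin d → I} (h : ∃ j, a j = 1 ∨ b j = 0) :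
    sigmoidPi ⁻¹' Icc a b = ∅ := by
  obtain ⟨j, hj⟩ := h
  refine Set.eq_empty_of_forall_notMem fun x hx => ?_
  rcases hj with hj | hj
  · have h1 := Subtype.coe_le_coe.2 (hx.1 j)
    rw [hj] at h1
    exact not_lt.2 h1 (unitInterval.sigmoid_lt_one (x j))
  · have h0 := Subtype.coe_le_coe.2 (hx.2 j)
    rw [hj] at h0
    exact not_lt.2 h0 (unitInterval.sigmoid_pos (x j))

/-- **Box-TP₂ passes from `ℝ^d` to the law of the coordinatewise sigmoid on `Q_d`.** [this work] -/
theorem IsBoxTP2.map_sigmoidPi (ν : Measure (Fin d → ℝ)) (hν : IsBoxTP2 ν) : IsBoxTP2 (ν.map sigmoidPi) := by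
  intro a b a' b'
  simp only [Measure.map_apply measurable_sigmoidPi measurableSet_Icc]
  by_cases hdeg : ∃ j, a j = 1 ∨ b j = 0
  · rw [sigmoidPi_preimage_Icc_eq_empty hdeg, measure_empty, zero_mul]; exact zero_le
  by_cases hdeg' : ∃ j, a' j = 1 ∨ b' j = 0
  · rw [sigmoidPi_preimage_Icc_eq_empty hdeg', measure_empty, mul_zero]; exact zero_le
  simp only [not_exists, not_or] at hdeg hdeg'
  have ha : ∀ j, ((a j : I) : ℝ) < 1 := fun j => lt_of_le_of_ne (a j).2.2 fun h => (hdeg j).1 (Subtype.ext h)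
  have hb : ∀ j, (0 : ℝ) < ((b j : I) : ℝ) := fun j =>
    lt_of_le_of_ne (b j).2.1 fun h => (hdeg j).2 (Subtype.ext h.symm)
  have ha' : ∀ j, ((a' j : I) : ℝ) < 1 := fun j => lt_of_le_of_ne (a' j).2.2 fun h => (hdeg' j).1 (Subtype.ext h)
  have hb' : ∀ j, (0 : ℝ) < ((b' j : I) : ℝ) := fun j =>
    lt_of_le_of_ne (b' j).2.1 fun h => (hdeg' j).2 (Subtype.ext h.symm)
  have hai : ∀ j, (((a ⊓ a') j : I) : ℝ) < 1 := fun j =>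
    lt_of_le_of_lt (Subtype.coe_le_coe.2 (inf_le_left : (a ⊓ a') j ≤ a j)) (ha j)
  have has : ∀ j, (((a ⊔ a') j : I) : ℝ) < 1 := fun j => by
    change (((a j ⊔ a' j) : I) : ℝ) < 1
    rcases le_total (a j) (a' j) with h | h
    · rw [sup_eq_right.2 h]; exact ha' j
    · rw [sup_eq_left.2 h]; exact ha j
  have hbi : ∀ j, (0 : ℝ) < (((b ⊓ b') j : I) : ℝ) := fun j => by
    change (0 : ℝ) < (((b j ⊓ b' j) : I) : ℝ)
    rcases le_total (b j) (b' j) with h | h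
    · rw [inf_eq_left.2 h]; exact hb j
    · rw [inf_eq_right.2 h]; exact hb' j
  have hbs : ∀ j, (0 : ℝ) < (((b ⊔ b') j : I) : ℝ) := fun j =>
    lt_of_lt_of_le (hb j) (Subtype.coe_le_coe.2 (le_sup_left : b j ≤ (b ⊔ b') j))
  rw [sigmoidPi_preimage_Icc_eq_iUnion a b, sigmoidPi_preimage_Icc_eq_iUnion a' b',
    sigmoidPi_preimage_Icc_eq_iUnion (a ⊓ a') (b ⊓ b'), sigmoidPi_preimage_Icc_eq_iUnion (a ⊔ a') (b ⊔ b')]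
  refine measure_mul_le_of_monotone_iUnion ν (monotone_truncBox a b) (monotone_truncBox a' b')
    (monotone_truncBox _ _) (monotone_truncBox _ _) fun k => ?_
  have hp1 := sup_loLevel_mem_openCube ha k
  have hq1 := inf_hiLevel_mem_openCube hb k
  have hp2 := sup_loLevel_mem_openCube ha' k
  have hq2 := inf_hiLevel_mem_openCube hb' k
  have e1 : a ⊓ a' ⊔ loLevel d k = (a ⊔ loLevel d k) ⊓ (a' ⊔ loLevel d k) := sup_inf_right _ _ _
  have e2 : b ⊓ b' ⊓ hiLevel d k = (b ⊓ hiLevel d k) ⊓ (b' ⊓ hiLevel d k) := inf_inf_distrib_right _ _ _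
  have e3 : a ⊔ a' ⊔ loLevel d k = (a ⊔ loLevel d k) ⊔ (a' ⊔ loLevel d k) := sup_sup_distrib_right _ _ _
  have e4 : (b ⊔ b') ⊓ hiLevel d k = (b ⊓ hiLevel d k) ⊔ (b' ⊓ hiLevel d k) := inf_sup_right _ _ _
  change ν (sigmoidPi ⁻¹' Icc (a ⊔ loLevel d k) (b ⊓ hiLevel d k)) *
      ν (sigmoidPi ⁻¹' Icc (a' ⊔ loLevel d k) (b' ⊓ hiLevel d k)) ≤
    ν (sigmoidPi ⁻¹' Icc (a ⊓ a' ⊔ loLevel d k) (b ⊓ b' ⊓ hiLevel d k)) *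
      ν (sigmoidPi ⁻¹' Icc (a ⊔ a' ⊔ loLevel d k) ((b ⊔ b') ⊓ hiLevel d k))
  rw [sigmoidPi_preimage_Icc hp1 hq1, sigmoidPi_preimage_Icc hp2 hq2,
    sigmoidPi_preimage_Icc (sup_loLevel_mem_openCube hai k) (inf_hiLevel_mem_openCube hbi k),
    sigmoidPi_preimage_Icc (sup_loLevel_mem_openCube has k) (inf_hiLevel_mem_openCube hbs k), e1, e2, e3, e4,
    logitPi_inf hp1 hp2, logitPi_inf hq1 hq2, logitPi_sup hp1 hp2, logitPi_sup hq1 hq2]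
  exact hν _ _ _ _

/-! ### Sahi positivity of box-TP₂ laws on `ℝ^d` -/

/-- The image law of the coordinatewise sigmoid is carried by the open cube. [folklore] -/
theorem ae_map_sigmoidPi_mem_openCube (ν : Measure (Fin d → ℝ)) :
    ∀ᵐ u ∂(ν.map sigmoidPi), u ∈ openCube d := by
  rw [ae_iff]
  change (ν.map sigmoidPi) (openCube d)ᶜ = 0
  rw [Measure.map_apply measurable_sigmoidPi measurableSet_openCube.compl]
  have h : sigmoidPi ⁻¹' (openCube d)ᶜ = ∅ :=
    Set.eq_empty_of_forall_notMem fun x hx => hx (sigmoidPi_mem_openCube x)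
  rw [h, measure_empty]

/-- **`LiebSahiContinuum d n` ⟹ every box-TP₂ probability measure on `ℝ^d` is Sahi-positive of order `n`** for all
bounded measurable nonnegative monotone families (coordinatewise sigmoid to `Q_d`, a.e.-monotone coupling there,
coordinatewise logit back — monotone on the open cube, which has full measure). [this work] -/
theorem msahiE_nonneg_of_isBoxTP2_real (h : LiebSahiContinuum d n) (ν : Measure (Fin d → ℝ))
    [IsProbabilityMeasure ν] (hν : IsBoxTP2 ν) (f : Fin n → (Fin d → ℝ) → ℝ) (hfm : ∀ i, Measurable (f i))
    (hf0 : ∀ i x, 0 ≤ f i x) {M : ℝ} (hfM : ∀ i x, f i x ≤ M) (hmono : ∀ i, Monotone (f i)) :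
    0 ≤ msahiE ν n f := by
  haveI : IsProbabilityMeasure (ν.map sigmoidPi) := Measure.isProbabilityMeasure_map measurable_sigmoidPi.aemeasurable
  obtain ⟨G, S, hGm, hS, hG, hGμ⟩ := exists_aemonotone_coupling d (ν.map sigmoidPi) (hν.map_sigmoidPi)
  have hν' : ν = (volume : Measure (Fin d → I)).map (logitPi ∘ G) := by
    rw [← Measure.map_map measurable_logitPi hGm, hGμ, Measure.map_map measurable_logitPi measurable_sigmoidPi]
    conv_lhs => rw [← Measure.map_id (μ := ν)]
    congr 1
    funext x
    exact (logitPi_sigmoidPi x).symm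
  have hGS : ∀ᵐ u ∂(volume : Measure (Fin d → I)), u ∈ S ∩ G ⁻¹' openCube d := by
    have h2 : ∀ᵐ u ∂(volume : Measure (Fin d → I)), G u ∈ openCube d := by
      have h3 := ae_map_sigmoidPi_mem_openCube ν
      rw [← hGμ] at h3
      exact ae_of_ae_map hGm.aemeasurable h3
    filter_upwards [hS, h2] with u h1 h2 using ⟨h1, h2⟩
  have hmono' : MonotoneOn (logitPi ∘ G) (S ∩ G ⁻¹' openCube d) := fun u hu v hv huv =>
    logitPi_monotoneOn hu.2 hv.2 (hG hu.1 hv.1 huv)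
  rw [hν']
  exact msahiE_map_nonneg_of_liebSahiContinuum_of_monotoneOn h (measurable_logitPi.comp hGm) hGS hmono' f hfm hf0
    (fun _ => M) hfM hmono

/-- The same for bounded measurable nonnegative ANTITONE families. [this work] -/
theorem msahiE_nonneg_of_isBoxTP2_real_antitone (h : LiebSahiContinuum d n) (ν : Measure (Fin d → ℝ))
    [IsProbabilityMeasure ν] (hν : IsBoxTP2 ν) (f : Fin n → (Fin d → ℝ) → ℝ) (hfm : ∀ i, Measurable (f i))
    (hf0 : ∀ i x, 0 ≤ f i x) {M : ℝ} (hfM : ∀ i x, f i x ≤ M) (hanti : ∀ i, Antitone (f i)) :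
    0 ≤ msahiE ν n f := by
  haveI : IsProbabilityMeasure (ν.map sigmoidPi) := Measure.isProbabilityMeasure_map measurable_sigmoidPi.aemeasurable
  obtain ⟨G, S, hGm, hS, hG, hGμ⟩ := exists_aemonotone_coupling d (ν.map sigmoidPi) (hν.map_sigmoidPi)
  have hν' : ν = (volume : Measure (Fin d → I)).map (logitPi ∘ G) := by
    rw [← Measure.map_map measurable_logitPi hGm, hGμ, Measure.map_map measurable_logitPi measurable_sigmoidPi]
    conv_lhs => rw [← Measure.map_id (μ := ν)]
    congr 1
    funext x
    exact (logitPi_sigmoidPi x).symm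
  have hGS : ∀ᵐ u ∂(volume : Measure (Fin d → I)), u ∈ S ∩ G ⁻¹' openCube d := by
    have h2 : ∀ᵐ u ∂(volume : Measure (Fin d → I)), G u ∈ openCube d := by
      have h3 := ae_map_sigmoidPi_mem_openCube ν
      rw [← hGμ] at h3
      exact ae_of_ae_map hGm.aemeasurable h3
    filter_upwards [hS, h2] with u h1 h2 using ⟨h1, h2⟩
  have hmono' : MonotoneOn (logitPi ∘ G) (S ∩ G ⁻¹' openCube d) := fun u hu v hv huv =>
    logitPi_monotoneOn hu.2 hv.2 (hG hu.1 hv.1 huv)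
  rw [hν']
  exact msahiE_map_nonneg_of_liebSahiContinuum_of_monotoneOn_antitone h (measurable_logitPi.comp hGm) hGS hmono' f
    hfm hf0 (fun _ => M) hfM hanti

/-! ### Sources on `ℝ^d`: MTP₂ densities for product reference measures; unconditional layers -/

/-- **MTP₂ densities give box-TP₂ laws on `ℝ^d`**: if `ρ : ℝ^d → [0,∞]` is measurable with
`ρ(x)ρ(y) ≤ ρ(x ∨ y)ρ(x ∧ y)` then `ρ · ⊗_j μ_j` is box-TP₂ for ANY σ-finite reference measures `μ_j` on `ℝ`
(Lebesgue: classical MTP₂ densities, e.g. Gaussian vectors whose precision matrix has nonpositive off-diagonal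
entries; counting measure on `ℤ ⊂ ℝ`: discrete MTP₂ laws).  Karlin–Rinott's four functions theorem with the four
functions `ρ·1_{box}`. [folklore] -/
theorem IsBoxTP2.withDensity_pi (μ : Fin d → Measure ℝ) [∀ i, SigmaFinite (μ i)] (ρ : (Fin d → ℝ) → ℝ≥0∞)
    (hρm : Measurable ρ) (hρ : ∀ x y, ρ x * ρ y ≤ ρ (x ⊔ y) * ρ (x ⊓ y)) :
    IsBoxTP2 ((Measure.pi μ).withDensity ρ) := by
  intro a b a' b'
  rw [withDensity_apply _ measurableSet_Icc, withDensity_apply _ measurableSet_Icc,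
    withDensity_apply _ measurableSet_Icc, withDensity_apply _ measurableSet_Icc, ← lintegral_indicator measurableSet_Icc,
    ← lintegral_indicator measurableSet_Icc, ← lintegral_indicator measurableSet_Icc,
    ← lintegral_indicator measurableSet_Icc, mul_comm (∫⁻ x, (Icc (a ⊓ a') (b ⊓ b')).indicator ρ x ∂Measure.pi μ)]
  refine Literature.Probability.LatticeModels.lintegral_four_functions μ _ _ _ _ (hρm.indicator measurableSet_Icc)
    (hρm.indicator measurableSet_Icc) (hρm.indicator measurableSet_Icc) (hρm.indicator measurableSet_Icc)
    fun x y => ?_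
  by_cases hx : x ∈ Icc a b
  · by_cases hy : y ∈ Icc a' b'
    · rw [indicator_of_mem hx, indicator_of_mem hy,
        indicator_of_mem (show x ⊔ y ∈ Icc (a ⊔ a') (b ⊔ b') from ⟨sup_le_sup hx.1 hy.1, sup_le_sup hx.2 hy.2⟩),
        indicator_of_mem (show x ⊓ y ∈ Icc (a ⊓ a') (b ⊓ b') from ⟨inf_le_inf hx.1 hy.1, inf_le_inf hx.2 hy.2⟩)]
      exact hρ x y
    · rw [indicator_of_notMem hy, mul_zero]
      exact zero_le
  · rw [indicator_of_notMem hx, zero_mul]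
    exact zero_le

/-- **Unconditionally, `d ≤ 2`**: every box-TP₂ probability measure on `ℝ` or `ℝ²` is Sahi-positive of EVERY
order for all bounded measurable nonnegative monotone families. [this work] -/
theorem msahiE_nonneg_of_isBoxTP2_real_of_le_two (hd : d ≤ 2) (ν : Measure (Fin d → ℝ)) [IsProbabilityMeasure ν]
    (hν : IsBoxTP2 ν) (n : ℕ) (f : Fin n → (Fin d → ℝ) → ℝ) (hfm : ∀ i, Measurable (f i))
    (hf0 : ∀ i x, 0 ≤ f i x) {M : ℝ} (hfM : ∀ i x, f i x ≤ M) (hmono : ∀ i, Monotone (f i)) :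
    0 ≤ msahiE ν n f :=
  msahiE_nonneg_of_isBoxTP2_real (liebSahiContinuum_of_le_two hd n) ν hν f hfm hf0 hfM hmono

/-- **Unconditionally, `n ≤ 2`** (the FKG inequality for box-TP₂ laws on `ℝ^d`, bounded measurable monotone pairs).
[this work] -/
theorem msahiE_nonneg_of_isBoxTP2_real_of_order_le_two (hn : n ≤ 2) (ν : Measure (Fin d → ℝ))
    [IsProbabilityMeasure ν] (hν : IsBoxTP2 ν) (f : Fin n → (Fin d → ℝ) → ℝ) (hfm : ∀ i, Measurable (f i))
    (hf0 : ∀ i x, 0 ≤ f i x) {M : ℝ} (hfM : ∀ i x, f i x ≤ M) (hmono : ∀ i, Monotone (f i)) :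
    0 ≤ msahiE ν n f :=
  msahiE_nonneg_of_isBoxTP2_real (liebSahiContinuum_of_order_le_two d hn) ν hν f hfm hf0 hfM hmono

end Summit.CriticalPhenomena.PercolationContinuityZ3.Theorems.SahiBoxTP2
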